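import Summits.ResolutionOfSingularities.ResolutionOfSingularities.Theorems.FrobeniusClosingPatchingRelPerfectDepthLegalRestartBoundary
import Summits.ResolutionOfSingularities.ResolutionOfSingularities.Theorems.FrobeniusClosingPatchingRelPerfectDepthFlagLegalPhasesGlue
import Summits.ResolutionOfSingularities.ResolutionOfSingularities.Theorems.FrobeniusClosingPatchingRelPerfectDepthFlagLegalPhaseTwoHolds
import Summits.ResolutionOfSingularities.ResolutionOfSingularities.Theorems.FrobeniusClosingPatchingRelPerfectDepthFlagLegalOldBoundaryOfF72
import Literature.AlgebraicGeometry.Resolution.EmbeddedResolutionExcellentSurfacesHistory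
import Literature.AlgebraicGeometry.Resolution.QuasiExcellentClosedSubschemes
import Literature.AlgebraicGeometry.Resolution.QuasiExcellentSchemes
import Literature.AlgebraicGeometry.Resolution.RegularLocusDense
import Literature.AlgebraicGeometry.Resolution.NonPrincipalLocus
import Mathlib.AlgebraicGeometry.Morphisms.Proper
import HarnessLib

/-!
# Crux `PatchingRelPerfect` (stmt-ResolutionOfSingularities-16161), chain W5.2 — T6-E1b residual: **`SingCentres₃` FROM THE CJS
# CONSTRUCTION FACT (F-72)** — the RESTART LOOP

[OURS · L1 W5.2 · `SingCentres₃` discharge = RESTART AT THE FIRST REGULAR COMPONENT (res-L1-w52-plan-1 RULING R4 (3); res-type-049;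
OWNER res-L1-w52-idea-1 NOTE O3.1, anchors (α)(β)(γ)), brick R6 = THE LOOP] NOT statements of the manuscript under review. The
Literature named fact F-72 `CossartJannsenSaito2020_canonicalSequence_history` (Cossart–Jannsen–Saito 2020, Cor. 6.26 (proof) with
Def. 6.23, Thm. 6.25/6.28, Thm. 6.9 (a); res-lit-6) enters as a HYPOTHESIS; nothing else is assumed.

THE THEOREM. `singCentres₃_of_canonicalSequence_history : CossartJannsenSaito2020_canonicalSequence_history → SingCentres₃`:
for a non-zero locally principal (reduced) `H` on an integral Noetherian regular excellent threefold `E`, SOME sequence of blowings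
up in regular centres INSIDE THE SINGULAR LOCI of the successive strict transforms of `Supp H`, normal crossings with the exceptional
boundary (`IsBPermissibleSequence (Supp H) ∅ π X₁ B₁`), ends with a REGULAR reduced strict transform — the OURS binder of the chain's
phase 1 (`DepthTargets.SingCentres₃`, `…DepthFlagLegalPhases`), hence (Γ `legalPhaseOne₃_of_singCentres₃` over res-type-049's
`WeightTwoB.legalPhaseOne_of_truncated`) `LegalPhaseOne₃` modulo F-72 only.

THE PROOF (plan-1 R4 (3) «RESTART AT THE FIRST REGULAR COMPONENT», tri-1 v18 (2), owner O2.2/O3.1). State: a Sing-centred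
`IsBPermissibleSequence (Supp H) ∅ σ X_j B_j` to a stage `Z_j` (integral Noetherian regular excellent threefold, `B_j` s.n.c.) whose
strict transform splits `X_j = Y ⊔ F` into a closed relatively-open UNFROZEN part `Y` and a FROZEN part `F`, a regular reduced
closed subscheme. If `Y = ∅`, done. Else RESTART: run F-72 on the reduced subscheme on `Y` inside `Z_j` with boundary `B_j`
(presented by its irreducible components, brick R5; `dim Y ≤ 2`; no component of `Y` in `B_j` because `B_j` lies off the preimage of
the regular locus `U₀` of `Supp H` while `Y`'s points over `U₀` are dense, bricks R2/R5), and read the process with brick R4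
`process_prefix`: EITHER the whole process is Sing-centred — then F-72's end clause «reduced strict transform regular» and the frozen
ride-along (brick R1) finish — OR it is Sing-centred up to a CUT stage carrying a new frozen piece `F'` (brick R3, from Def. 6.23 (2)
and Lemma 2.31); then freeze `F' ⊔ (lift of F)`, continue with the unfrozen `Y' = Y_c ∖ F'`, and recurse. TERMINATION: the closed
image `σ(Y) ⊆ E` strictly decreases (brick R2 `exists_mem_not_mem_image`: `F'` has a point over `U₀` not hit by `Y'`; images of the
closed `Y'` are closed, the sequence being proper) — Noetherian induction on `Closeds E`.

AI-written; AI review is weaker than expert review.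

## References
* V. Cossart, U. Jannsen, S. Saito, LNM 2270 (2020), Cor. 6.26 (proof), Def. 6.23 (2)(3), Thm. 6.25, Thm. 6.28, Thm. 6.9 (a),
  Lemma 2.31, Def. 4.3/4.4. [CossartJannsenSaito2020]
* The Stacks Project, Tags 02OS, 0052, 0BIA. [StacksProject]
-/

-- `Summit.<Summit>.<Sub>.Theorems` with `Sub = Summit` (single-conjunct summit, D-0017)
set_option linter.dupNamespace false

noncomputable section

open CategoryTheory CategoryTheory.Limits AlgebraicGeometry TopologicalSpace IsLocalRing
open Literature.AlgebraicGeometry.Resolution Scheme.IdealSheafData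
open Literature.AlgebraicGeometry.Resolution.CJSHistory

namespace Summit.ResolutionOfSingularities.ResolutionOfSingularities.Theorems

universe u

namespace LegalRestart

/-! ## §1 A CJS-type sequence is proper, hence a closed map -/

/-- **A sequence of complete `𝓑`-permissible blowings up is proper** (each blowing up is). [cite: StacksProject, Tag 02ND] -/
theorem seq_isProper {E : Scheme.{u}} [IsLocallyNoetherian E] {X B : Set E} :
    ∀ {Z' : Scheme.{u}} {σ : Z' ⟶ E} {X' B' : Set Z'}, IsBPermissibleSequence X B σ X' B' →
      ∃ _ : IsLocallyNoetherian Z', IsProper σ := by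
  intro Z' σ X' B' h
  induction h with
  | refl => exact ⟨inferInstance, inferInstance⟩
  | @blowup Z' Z'' σ X' B' h C τ hτ hreg hsub hsing hperm hnc ih =>
    obtain ⟨hln, hσ⟩ := ih
    haveI := hln
    haveI := hσ
    haveI : IsLocallyNoetherian Z'' := hτ.isLocallyNoetherian
    haveI := hτ.isProper
    exact ⟨inferInstance, inferInstance⟩

/-! ## §2 The restart loop (Noetherian induction on the image of the unfrozen part) -/

/-- **THE RESTART LOOP** (see the module docstring): from any state — a Sing-centred sequence from `(E, X, ∅)` to a stage
`Z_j` with strict transform `X_j = Y ⊔ F` (`Y` unfrozen, closed and relatively open; `F` frozen, regular), `Z_j` integral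
Noetherian regular excellent of dimension three, `B_j` s.n.c., `Y ⊊ Z_j`, `σ(Y) ⊆ T` — a Sing-centred sequence from `(E, X, ∅)`
ending with a REGULAR reduced strict transform exists; by Noetherian induction on the closed `T ⊆ E`.
[cite: CossartJannsenSaito2020, Cor. 6.26 (proof), Def. 6.23, Thm. 6.9 (a)] -/
theorem restart_loop (hF : CossartJannsenSaito2020_canonicalSequence_history.{u})
    {E : Scheme.{u}} [IsIntegral E] [IsNoetherian E] {X : Set E} (hX : IsClosed X) (U₀ : E.Opens)
    (hreg : ∀ x ∈ X ∩ (U₀ : Set E), IsRegularLocalRing (E.presheaf.stalk x ⧸ stalkIdeal (vanishingIdeal ⟨X, hX⟩) x))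
    (hdense : X ⊆ closure (X ∩ (U₀ : Set E))) :
    ∀ (T : Closeds E) {Zj : Scheme.{u}} [IsIntegral Zj] [IsNoetherian Zj] (σ : Zj ⟶ E) (Xj Bj Y F : Set Zj)
      (hF' : IsClosed F),
      IsBPermissibleSequence X (∅ : Set E) σ Xj Bj → IsClosed Xj → Scheme.IsRegular Zj → Scheme.IsExcellent Zj →
      topologicalKrullDim Zj = 3 → IsStrictNormalCrossingsDivisor Zj Bj →
      Y ∪ F = Xj → IsClosed Y → Y ≠ Set.univ → (∃ W : Set Zj, IsOpen W ∧ Xj ∩ W = Y) → Disjoint Y F →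
      Scheme.IsRegular (vanishingIdeal (⟨F, hF'⟩ : Closeds Zj)).subscheme →
      σ '' Y ⊆ (T : Set E) →
      ∃ (Z₁ : Scheme.{u}) (π : Z₁ ⟶ E) (X₁ B₁ : Set Z₁),
        IsBPermissibleSequence X (∅ : Set E) π X₁ B₁ ∧
        Scheme.IsRegular (vanishingIdeal ⟨closure X₁, isClosed_closure⟩).subscheme := by
  intro T
  induction T using WellFoundedLT.induction with | ind T ih => ?_
  intro Zj _ _ σ Xj Bj Y F hFc hseq hXjc hZj hexcj hdimj hBj hYF hYc hYne hYo hYFd hFreg hYT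
  by_cases hY0 : Y = ∅
  · /- nothing left to resolve: the strict transform is the frozen (regular) part -/
    subst hY0
    rw [Set.empty_union] at hYF
    subst hYF
    refine ⟨Zj, σ, F, Bj, hseq, ?_⟩
    have hcl : (⟨closure F, isClosed_closure⟩ : Closeds Zj) = ⟨F, hFc⟩ := Closeds.ext hFc.closure_eq
    rw [hcl]; exact hFreg
  /- RESTART on the unfrozen part `Y` -/
  obtain ⟨W, hW, hWY⟩ := hYo
  -- the data of the Sing-centred sequence so far (brick R2) and the boundary off `U₀` (brick R5)
  obtain ⟨-, -, -, -, hdenj⟩ := seq_over_regularLocus hX U₀ hreg hdense hseq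
  have hBoff : Disjoint Bj (σ ⁻¹' (U₀ : Set E)) :=
    seq_boundary_disjoint hX U₀ hreg hdense (B := (∅ : Set E)) (by simp) hseq
  have hdenY : Y ⊆ closure (Y ∩ σ ⁻¹' (U₀ : Set E)) := subset_closure_inter_of_piece hW hWY hdenj
  -- the reduced closed subscheme on `Y`
  set I : Zj.IdealSheafData := vanishingIdeal (⟨Y, hYc⟩ : Closeds Zj) with hIdef
  haveI : IsReduced I.subscheme := isReduced_subscheme_vanishingIdeal ⟨Y, hYc⟩
  have hrange : Set.range I.subschemeι = Y := range_subschemeι_vanishingIdeal ⟨Y, hYc⟩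
  have hdimS : topologicalKrullDim ↥(I.subscheme) ≤ 2 := topologicalKrullDim_subscheme_le_two hdimj hYc hYne
  -- the boundary presented by its irreducible components
  obtain ⟨Bf, k, hU, hk, hirr, hinj, hBfcl⟩ := exists_boundary_presentation hZj hBj
  have hBfsnc : IsStrictNormalCrossingsDivisor Zj (⋃ j, Bf j) := by rw [hU]; exact hBj
  have hnocomp : ∀ T' ∈ irreducibleComponents ↥(I.subscheme), ¬ T' ⊆ I.subschemeι ⁻¹' ⋃ j, Bf j := by
    rw [hU]; exact forall_irreducibleComponents_not_subset σ U₀ hYc hdenY hBoff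
  -- F-72
  obtain ⟨Zp, π, Xp, Bp, kp, Op, hproc, -, -, -, -, -, hXpreg, -, -, -⟩ :=
    hF I.subscheme Zj I.subschemeι Bf k hZj hexcj hdimS hBfsnc hk hirr hinj hnocomp
  rw [hrange] at hproc
  -- read the Sing-centred prefix
  have hclY : closure Y = Y := hYc.closure_eq
  have hdYF : Disjoint (closure Y) F := by rw [hclY]; exact hYFd
  rcases process_prefix hexcj hdimj hYc hYne hBfcl hk (O := BoundaryHistory.boundaryAt Bf) (le_refl 2) hproc with
    ⟨hseqY, -, -, -, -, -, -, -, -, -⟩ |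
    ⟨Zc, hintc, hnoethc, ρc, Yc, Bc, F', hseqc, hYcc, hZc, hexcc, hdimc, hYcne, hBc, himgc, hF'Y, hF'ne, hF'c, ⟨O, hO, hOF'⟩,
      hF'reg⟩
  · /- CLEAN: the whole F-72 process was Sing-centred; its end is regular; the frozen part rides along -/
    obtain ⟨hseqYF, -, hln, -⟩ := seq_union_frozen hFc hdYF hFreg hseqY
    obtain ⟨-, hregEnd⟩ := isRegular_closure_union_frozen hFc hdYF hFreg hseqY hXpreg
    rw [hYF, hU] at hseqYF
    exact ⟨Zp, π ≫ σ, Xp ∪ π ⁻¹' F, ⋃ i, Bp i, seq_trans hseq hseqYF, hregEnd⟩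
  · /- CUT: freeze the new regular piece `F'` together with the lift of `F`, and recurse -/
    haveI := hintc
    haveI := hnoethc
    obtain ⟨hseqYF, hdisj, hln, hFreg'⟩ := seq_union_frozen hFc hdYF hFreg hseqc
    rw [hYF, hU] at hseqYF
    have hseq' : IsBPermissibleSequence X (∅ : Set E) (ρc ≫ σ) (Yc ∪ ρc ⁻¹' F) Bc := seq_trans hseq hseqYF
    have hYcl : closure Yc = Yc := hYcc.closure_eq
    rw [hYcl] at hdisj
    -- the new state
    set F'' : Set Zc := F' ∪ ρc ⁻¹' F with hF''def
    set Y' : Set Zc := Yc ∩ Oᶜ with hY'def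
    have hF''c : IsClosed F'' := hF'c.union (hFc.preimage ρc.continuous)
    have hY'c : IsClosed Y' := hYcc.inter hO.isClosed_compl
    have hF'O : F' ⊆ O := fun z hz => by rw [← hOF'] at hz; exact hz.2
    have hXj' : Y' ∪ F'' = Yc ∪ ρc ⁻¹' F := by
      apply Set.Subset.antisymm
      · rintro z (⟨hz, -⟩ | hz | hz)
        · exact Or.inl hz
        · exact Or.inl (hF'Y hz)
        · exact Or.inr hz
      · rintro z (hz | hz)
        · by_cases hzO : z ∈ O
          · exact Or.inr (Or.inl (by rw [← hOF']; exact ⟨hz, hzO⟩))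
          · exact Or.inl ⟨hz, hzO⟩
        · exact Or.inr (Or.inr hz)
    have hY'ne : Y' ≠ Set.univ := fun h => hYcne (Set.eq_univ_of_subset Set.inter_subset_left h)
    have hY'o : ∃ W' : Set Zc, IsOpen W' ∧ (Yc ∪ ρc ⁻¹' F) ∩ W' = Y' := by
      refine ⟨F''ᶜ, hF''c.isOpen_compl, ?_⟩
      ext z
      simp only [Set.mem_inter_iff, Set.mem_union, Set.mem_compl_iff, hF''def, hY'def, not_or, Set.mem_preimage]
      constructor
      · rintro ⟨hz | hz, hzF', hzF⟩
        · exact ⟨hz, fun hzO => hzF' (by rw [← hOF']; exact ⟨hz, hzO⟩)⟩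
        · exact absurd hz hzF
      · rintro ⟨hz, hzO⟩
        exact ⟨Or.inl hz, fun h => hzO (hF'O h), fun h => Set.disjoint_left.mp hdisj hz h⟩
    have hY'F'' : Disjoint Y' F'' := by
      refine Set.disjoint_left.mpr fun z hz hz' => ?_
      rcases hz' with hz' | hz'
      · exact hz.2 (hF'O hz')
      · exact Set.disjoint_left.mp hdisj hz.1 hz'
    -- the new frozen part is regular: `F'` (pointwise regular for `𝓘(Yc)`, a relatively open piece) ⊔ the lift of `F`
    have hF'sub : Scheme.IsRegular (vanishingIdeal (⟨F', hF'c⟩ : Closeds Zc)).subscheme := by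
      rw [Scheme.isRegular_subscheme_iff]
      intro y hy
      have hyF' : y ∈ F' := by
        rw [← SetLike.mem_coe, Scheme.IdealSheafData.coe_support_vanishingIdeal] at hy; exact hy
      have hcl : (⟨closure Yc, isClosed_closure⟩ : Closeds Zc) = ⟨Yc, hYcc⟩ := Closeds.ext hYcl
      have hloc : stalkIdeal (vanishingIdeal (⟨F', hF'c⟩ : Closeds Zc)) y =
          stalkIdeal (vanishingIdeal (⟨closure Yc, isClosed_closure⟩ : Closeds Zc)) y := by
        rw [hcl]
        refine stalkIdeal_vanishingIdeal_eq_of_inter_eq hO (hF'O hyF') ?_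
        show F' ∩ O = Yc ∩ O
        rw [← hOF', Set.inter_assoc, Set.inter_self]
      rw [hloc]
      exact hF'reg y hyF'
    have hF''reg : Scheme.IsRegular (vanishingIdeal (⟨F'', hF''c⟩ : Closeds Zc)).subscheme := by
      have hsup : (⟨F'', hF''c⟩ : Closeds Zc) = (⟨F', hF'c⟩ : Closeds Zc) ⊔ ⟨ρc ⁻¹' F, hFc.preimage ρc.continuous⟩ :=
        Closeds.ext (by simp [hF''def])
      rw [hsup]
      exact isRegular_subscheme_vanishingIdeal_sup
        (Set.disjoint_left.mpr fun z hz hz' => Set.disjoint_left.mp hdisj (hF'Y hz) hz') hF'sub hFreg'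
    -- the measure drops: `σ'(Y')` is a closed proper subset of `T`
    obtain ⟨_, hproper⟩ := seq_isProper hseq'
    haveI := hproper
    have hT'c : IsClosed (⇑(ρc ≫ σ) '' Y') := (ρc ≫ σ).isClosedMap _ hY'c
    set T' : Closeds E := ⟨⇑(ρc ≫ σ) '' Y', hT'c⟩ with hT'def
    have hYcT : ⇑(ρc ≫ σ) '' Yc ⊆ (T : Set E) := by
      rintro _ ⟨z, hz, rfl⟩
      exact hYT ⟨ρc z, himgc ⟨z, hz, rfl⟩, by simp⟩
    have hT'le : T' ≤ T := fun e he => by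
      obtain ⟨z, hz, rfl⟩ := he
      exact hYcT ⟨z, hz.1, rfl⟩
    have hT'lt : T' < T := by
      refine lt_of_le_of_ne hT'le fun heq => ?_
      obtain ⟨-, -, hinj', -, hden'⟩ := seq_over_regularLocus hX U₀ hreg hdense hseq'
      have hF'X : F' ⊆ Yc ∪ ρc ⁻¹' F := fun z hz => Or.inl (hF'Y hz)
      have hF'o : ∃ O' : Set Zc, IsOpen O' ∧ (Yc ∪ ρc ⁻¹' F) ∩ O' = F' := by
        refine ⟨O ∩ (ρc ⁻¹' F)ᶜ, hO.inter (hFc.preimage ρc.continuous).isOpen_compl, ?_⟩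
        ext z
        simp only [Set.mem_inter_iff, Set.mem_union, Set.mem_compl_iff, Set.mem_preimage]
        constructor
        · rintro ⟨hz | hz, hzO, hzF⟩
          · rw [← hOF']; exact ⟨hz, hzO⟩
          · exact absurd hz hzF
        · intro hz
          exact ⟨Or.inl (hF'Y hz), hF'O hz, fun h => Set.disjoint_left.mp hdisj (hF'Y hz) h⟩
      have hF'Y' : Disjoint F' Y' := Set.disjoint_left.mpr fun z hz hz' => hz'.2 (hF'O hz)
      obtain ⟨ξ, hξF', -, hξY'⟩ := exists_mem_not_mem_image U₀ hinj' hden' hF'X hF'o hF'ne hF'Y'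
      apply hξY'
      have hξT : (ρc ≫ σ) ξ ∈ (T : Set E) := hYcT ⟨ξ, hF'Y hξF', rfl⟩
      rw [← heq] at hξT
      exact hξT
    -- recurse
    exact ih T' hT'lt (ρc ≫ σ) (Yc ∪ ρc ⁻¹' F) Bc Y' F'' hF''c hseq' (hYcc.union (hFc.preimage ρc.continuous)) hZc hexcc
      hdimc hBc hXj' hY'c hY'ne hY'o hY'F'' hF''reg le_rfl

/-! ## §3 `SingCentres₃` from F-72 -/

/-- **`SingCentres₃` FROM THE CJS CONSTRUCTION FACT (F-72)** — the OURS binder of the chain's phase 1 is a THEOREM MODULO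
`CossartJannsenSaito2020_canonicalSequence_history` ONLY (see the module docstring): start the restart loop at
`(E, X = Supp H, ∅)` with nothing frozen, `U₀ = E ∖ Sing X` (the regular locus of the reduced structure on `X` is open — `X` is
quasi-excellent as a closed subscheme of the excellent `E` — and dense — `X` is reduced).
[cite: CossartJannsenSaito2020, Cor. 6.26 (proof), Def. 6.23, Thm. 6.9 (a), Lemma 2.31] -/
theorem singCentres₃_of_canonicalSequence_history (hF : CossartJannsenSaito2020_canonicalSequence_history.{u}) :
    DepthTargets.SingCentres₃.{u} := by
  intro E _ _ hreg hexc hdim H hH hlp _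
  set X : Set E := (H.support : Set E) with hXdef
  have hX : IsClosed X := H.support.isClosed
  have hXne : X ≠ Set.univ := fun h => not_mem_support_genericPoint hH (show genericPoint E ∈ X from h ▸ Set.mem_univ _)
  -- the reduced structure on `X`, its (open, dense) regular locus, and `U₀`
  set I : E.IdealSheafData := vanishingIdeal (⟨X, hX⟩ : Closeds E) with hIdef
  haveI : IsReduced I.subscheme := isReduced_subscheme_vanishingIdeal ⟨X, hX⟩
  have hrange : Set.range I.subschemeι = X := range_subschemeι_vanishingIdeal ⟨X, hX⟩
  have hqe : Scheme.IsQuasiExcellent I.subscheme :=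
    Scheme.IsQuasiExcellent.of_isClosedImmersion I.subschemeι hexc.isQuasiExcellent
  have hRo : IsOpen (Scheme.regularLocus I.subscheme) := Scheme.isOpen_regularLocus_of_isQuasiExcellent hqe
  have hRd : Dense (Scheme.regularLocus I.subscheme) := Scheme.dense_regularLocus _
  have hce := I.subschemeι.isClosedEmbedding
  set Sng : Set E := I.subschemeι '' (Scheme.regularLocus I.subscheme)ᶜ with hSng
  have hSngc : IsClosed Sng := hce.isClosedMap _ hRo.isClosed_compl
  let U₀ : E.Opens := ⟨Sngᶜ, hSngc.isOpen_compl⟩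
  -- `X ∩ U₀` consists of regular points of the reduced structure
  have hregU : ∀ x ∈ X ∩ (U₀ : Set E), IsRegularLocalRing (E.presheaf.stalk x ⧸ stalkIdeal I x) := by
    rintro x ⟨hxX, hxU⟩
    obtain ⟨t, rfl⟩ : x ∈ Set.range I.subschemeι := by rw [hrange]; exact hxX
    have ht : t ∈ Scheme.regularLocus I.subscheme := by
      by_contra h
      exact hxU ⟨t, h, rfl⟩
    obtain ⟨e⟩ := DepthLegal.nonempty_stalk_subscheme_ringEquiv I t
    haveI : IsRegularLocalRing (I.subscheme.presheaf.stalk t) := ht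
    exact IsRegularLocalRing.of_ringEquiv e.symm
  -- and is dense in `X`
  have hdenseU : X ⊆ closure (X ∩ (U₀ : Set E)) := by
    intro x hxX
    obtain ⟨t, rfl⟩ : x ∈ Set.range I.subschemeι := by rw [hrange]; exact hxX
    have h1 : I.subschemeι t ∈ closure (I.subschemeι '' Scheme.regularLocus I.subscheme) :=
      image_closure_subset_closure_image I.subschemeι.continuous ⟨t, hRd t, rfl⟩
    refine closure_mono ?_ h1
    rintro _ ⟨r, hr, rfl⟩
    refine ⟨hrange ▸ Set.mem_range_self r, fun h => ?_⟩
    obtain ⟨r', hr', hrr'⟩ := h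
    exact hr' (hce.injective hrr' ▸ hr)
  -- the empty frozen part is regular
  have h0reg : Scheme.IsRegular (vanishingIdeal (⟨(∅ : Set E), isClosed_empty⟩ : Closeds E)).subscheme := by
    rw [Scheme.isRegular_subscheme_iff]
    intro x hx
    rw [← SetLike.mem_coe, Scheme.IdealSheafData.coe_support_vanishingIdeal] at hx
    exact absurd hx (Set.notMem_empty x)
  -- run the loop from `(E, X, ∅)`, nothing frozen
  obtain ⟨Z₁, π, X₁, B₁, hseq, hreg₁⟩ := restart_loop hF hX U₀ hregU hdenseU ⟨X, hX⟩ (𝟙 E) X ∅ X ∅ isClosed_empty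
    IsBPermissibleSequence.refl hX hreg hexc hdim (IsStrictNormalCrossingsDivisor.empty E) (Set.union_empty X) hX hXne
    ⟨Set.univ, isOpen_univ, Set.inter_univ X⟩ (Set.disjoint_empty X) h0reg (by simp)
  exact ⟨Z₁, π, X₁, B₁, hseq, hreg₁⟩

/-- **COROLLARY: `LegalPhaseOne₃` is a theorem modulo F-72 only** (res-L1-w52-idea-1's Γ `legalPhaseOne₃_of_singCentres₃` over
res-type-049's `WeightTwoB.legalPhaseOne_of_truncated`, composed with `singCentres₃_of_canonicalSequence_history`).
[cite: CossartJannsenSaito2020, Cor. 6.26, Thm. 6.9 (a)] -/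
theorem legalPhaseOne₃_of_canonicalSequence_history (hF : CossartJannsenSaito2020_canonicalSequence_history.{u}) :
    DepthTargets.LegalPhaseOne₃.{u} :=
  DepthTargets.legalPhaseOne₃_of_singCentres₃ (singCentres₃_of_canonicalSequence_history hF)

/-- **COROLLARY: `LegalScopedDivisorReduction₃` modulo F-72 and `LegalPhaseTwo₃` only** (Γ
`legalScopedDivisorReduction₃_of_singCentres₃_of_phaseTwo`). [cite: CossartJannsenSaito2020, Cor. 6.26] -/
theorem legalScopedDivisorReduction₃_of_canonicalSequence_history_of_phaseTwo
    (hF : CossartJannsenSaito2020_canonicalSequence_history.{u}) (h2 : DepthTargets.LegalPhaseTwo₃.{u}) :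
    DepthTargets.LegalScopedDivisorReduction₃.{u} :=
  DepthTargets.legalScopedDivisorReduction₃_of_singCentres₃_of_phaseTwo (singCentres₃_of_canonicalSequence_history hF) h2

/-! ## rev 2 (append-only): `LegalScopedDivisorReduction₃` modulo F-72 ALONE -/

/-- **`LegalScopedDivisorReduction₃` IS A THEOREM MODULO F-72 ALONE**: phase 1 by the restart loop
(`singCentres₃_of_canonicalSequence_history`), phase 2 by res-D-pv-016's (K-b) `DepthLegal.oldBoundaryResolution₃_of_F72` through
`DepthTargets.legalPhaseTwo₃_of_oldBoundary`, phase 3 a tree theorem, glued by res-L1-w52-idea-1's Γ. The T6-E1b residual at `ℓ = 2`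
thus hangs on the single Literature CONSTRUCTION-fact `CossartJannsenSaito2020_canonicalSequence_history` (statement-only) — NOT on a
statement of the manuscript under review. [cite: CossartJannsenSaito2020, Cor. 6.26 (proof), Thm. 6.9 (a), Thm. 1.4] -/
theorem legalScopedDivisorReduction₃_of_canonicalSequence_history (hF : CossartJannsenSaito2020_canonicalSequence_history.{u}) :
    DepthTargets.LegalScopedDivisorReduction₃.{u} :=
  legalScopedDivisorReduction₃_of_canonicalSequence_history_of_phaseTwo hF
    (DepthTargets.legalPhaseTwo₃_of_oldBoundary (DepthLegal.oldBoundaryResolution₃_of_F72 hF))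

end LegalRestart

end Summit.ResolutionOfSingularities.ResolutionOfSingularities.Theorems

end
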